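import Summits.QuantumFields.QCD.Theses.HeatSlicedQuarks

/-!
# Stub `stub_besselCount` of line `Sketch` (idea `drop-the-wilson-square`)
(crux `Summit.QuantumFields.QCD.Theses.HeatSlicedQuarks.ActionBoundsLowModes`, item stmt-QuantumFields-8872,
route route-QuantumFields-HeatSlicedQuarks)

## Summary

This file proves the min–max-free Hilbert–Schmidt counting lemma used by the abstract CLR engine
of the crux: if `G ⊆ ℂⁿ` is a complex subspace on which `Σ_i |g_i|² ≤ 4 Σ_i |(M g)_i|²`, then
`dim G ≤ 4 Σ_{i,j} |M_{ij}|²`.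

Proof.  Transport `G` along the linear equivalence `WithLp.linearEquiv 2 ℂ (n → ℂ)` to a submodule
`G'` of the inner-product space `E := EuclideanSpace ℂ n` (same `finrank`,
`LinearEquiv.finrank_map_eq`), where `‖x‖² = Σ_i |x_i|²` (`EuclideanSpace.norm_sq_eq`).  Let
`g₁, …, g_N` (`N = dim G`) be the standard orthonormal basis of `G'` (`stdOrthonormalBasis`),
viewed in `E`; it is an orthonormal family (`LinearIsometry.orthonormal_comp_iff` for the
isometric inclusion `G'.subtypeₗᵢ`).  For a row index `i` put `r_i := conj (row_i M) ∈ E`, so that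
`(M x)_i = ⟪r_i, x⟫` and `‖r_i‖² = Σ_j |M_{ij}|²`.  Then
`N = Σ_j ‖g_j‖² ≤ 4 Σ_j Σ_i |(M g_j)_i|² = 4 Σ_i Σ_j |⟪g_j, r_i⟫|² ≤ 4 Σ_i ‖r_i‖² = 4 Σ_{i,j} |M_{ij}|²`,
the last inequality being Bessel's inequality (`Orthonormal.sum_inner_products_le`) for the
orthonormal family `(g_j)` against each vector `r_i`.
-/

namespace Summit.QuantumFields.QCD.Cruxes.ActionBoundsLowModes.DropTheWilsonSquare

open Literature.MathematicalPhysics Literature.MathematicalPhysics.QuantumLattice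
  Literature.MathematicalPhysics.QuantumFieldTheory Literature.Probability.LatticeModels
open Matrix
open scoped Kronecker ComplexOrder InnerProductSpace

/-- The `i`-th entry of `M *ᵥ x` is the Euclidean inner product of `x` with the conjugated
`i`-th row of `M`. -/
private theorem mulVec_ofLp_eq_inner {n : Type} [Fintype n] (M : Matrix n n ℂ) (i : n)
    (x : EuclideanSpace ℂ n) :
    (M *ᵥ WithLp.ofLp x) i = ⟪WithLp.toLp 2 (star (M i)), x⟫_ℂ := by
  rw [EuclideanSpace.inner_eq_star_dotProduct, WithLp.ofLp_toLp, star_star, Matrix.mulVec,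
    dotProduct_comm]

/-- The Euclidean norm squared of the conjugated `i`-th row of `M` is `Σ_j |M_{ij}|²`. -/
private theorem norm_sq_toLp_star_row {n : Type} [Fintype n] (M : Matrix n n ℂ) (i : n) :
    ‖(WithLp.toLp 2 (star (M i)) : EuclideanSpace ℂ n)‖ ^ 2 = ∑ j, ‖M i j‖ ^ 2 := by
  rw [EuclideanSpace.norm_sq_eq]
  refine Finset.sum_congr rfl fun j _ => ?_
  simp

/-- **Bessel step.**  For an orthonormal family `g` in `EuclideanSpace ℂ n` and a row index `i`,
`Σ_j |(M g_j)_i|² ≤ Σ_j |M_{ij}|²`. -/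
private theorem sum_norm_sq_mulVec_le_row {n : Type} [Fintype n] {ι : Type} [Fintype ι]
    (M : Matrix n n ℂ) {g : ι → EuclideanSpace ℂ n} (hg : Orthonormal ℂ g) (i : n) :
    ∑ j, ‖(M *ᵥ WithLp.ofLp (g j)) i‖ ^ 2 ≤ ∑ j, ‖M i j‖ ^ 2 := by
  rw [← norm_sq_toLp_star_row M i]
  calc ∑ j, ‖(M *ᵥ WithLp.ofLp (g j)) i‖ ^ 2
        = ∑ j, ‖⟪g j, WithLp.toLp 2 (star (M i))⟫_ℂ‖ ^ 2 := by
          refine Finset.sum_congr rfl fun j _ => ?_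
          rw [mulVec_ofLp_eq_inner, norm_inner_symm]
    _ ≤ ‖(WithLp.toLp 2 (star (M i)) : EuclideanSpace ℂ n)‖ ^ 2 :=
          hg.sum_inner_products_le _

/-- **Stub C1b (`stub_besselCount`, Hilbert–Schmidt counting, min–max free).**  If `G` is a complex
subspace of `ℂⁿ` on which `Σ_i |g_i|² ≤ 4 Σ_i |(M g)_i|²`, then `dim G ≤ 4 Σ_{i,j} |M_{ij}|²`.
Proof sketch: take an orthonormal basis `g₁,…,g_N` of `G` (transfer to `EuclideanSpace ℂ n`,
`stdOrthonormalBasis`); `N = Σ_j ‖g_j‖² ≤ 4 Σ_j ‖M g_j‖² = 4 Σ_i Σ_j |⟨r_i, g_j⟩|²` with `r_i = conj (row_i M)`,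
and Bessel (`Orthonormal.sum_inner_products_le`) gives `Σ_j |⟨r_i,g_j⟩|² ≤ ‖r_i‖² = Σ_j |M_{ij}|²`. -/
theorem stub_besselCount :
    ∀ {n : Type} [Fintype n] [DecidableEq n] (M : Matrix n n ℂ) (G : Submodule ℂ (n → ℂ)),
      (∀ g ∈ G, ∑ i, ‖g i‖ ^ 2 ≤ 4 * ∑ i, ‖(M *ᵥ g) i‖ ^ 2) →
        (Module.finrank ℂ G : ℝ) ≤ 4 * ∑ i, ∑ j, ‖M i j‖ ^ 2 := by
  intro n _ _ M G hG
  -- Step 1: transport `G` to the Euclidean space `E`.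
  set e : EuclideanSpace ℂ n ≃ₗ[ℂ] (n → ℂ) := WithLp.linearEquiv 2 ℂ (n → ℂ) with he
  set G' : Submodule ℂ (EuclideanSpace ℂ n) :=
    G.map (e.symm : (n → ℂ) →ₗ[ℂ] EuclideanSpace ℂ n) with hG'
  have hrank : Module.finrank ℂ G' = Module.finrank ℂ G := LinearEquiv.finrank_map_eq e.symm G
  -- Step 2: an orthonormal basis of `G'`, viewed as an orthonormal family of `E`.
  set b := stdOrthonormalBasis ℂ G'
  set g : Fin (Module.finrank ℂ G') → EuclideanSpace ℂ n := fun j => (b j : EuclideanSpace ℂ n)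
    with hg
  have hg_on : Orthonormal ℂ g := by
    rw [hg]
    exact b.orthonormal.comp_linearIsometry G'.subtypeₗᵢ
  -- membership: the underlying function of `g j` lies in `G`.
  have hg_mem : ∀ j, (WithLp.ofLp (g j) : n → ℂ) ∈ G := by
    intro j
    have hj : g j ∈ G' := (b j).2
    rw [hG', Submodule.mem_map] at hj
    obtain ⟨y, hy, hy'⟩ := hj
    rw [← hy']
    simpa [he] using hy
  -- Step 3: each `g j` has unit norm.
  have hg_norm : ∀ j, ∑ i, ‖g j i‖ ^ 2 = 1 := by
    intro j
    rw [← EuclideanSpace.norm_sq_eq, hg_on.1 j, one_pow]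
  -- Steps 4–5: combine the hypothesis with the Bessel step.
  have hmain : ((Module.finrank ℂ G' : ℕ) : ℝ) ≤ 4 * ∑ i, ∑ j, ‖M i j‖ ^ 2 := by
    calc ((Module.finrank ℂ G' : ℕ) : ℝ)
          = ∑ j : Fin (Module.finrank ℂ G'), ∑ i, ‖g j i‖ ^ 2 := by
            simp only [hg_norm, Finset.sum_const, Finset.card_univ, Fintype.card_fin,
              nsmul_eq_mul, mul_one]
      _ ≤ ∑ j : Fin (Module.finrank ℂ G'), 4 * ∑ i, ‖(M *ᵥ WithLp.ofLp (g j)) i‖ ^ 2 :=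
            Finset.sum_le_sum fun j _ => hG _ (hg_mem j)
      _ = 4 * ∑ i, ∑ j : Fin (Module.finrank ℂ G'), ‖(M *ᵥ WithLp.ofLp (g j)) i‖ ^ 2 := by
            rw [← Finset.mul_sum, Finset.sum_comm]
      _ ≤ 4 * ∑ i, ∑ j, ‖M i j‖ ^ 2 := by
            gcongr with i
            exact sum_norm_sq_mulVec_le_row M hg_on i
  rw [← hrank]
  exact hmain

end Summit.QuantumFields.QCD.Cruxes.ActionBoundsLowModes.DropTheWilsonSquare
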